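/-
Copyright (c) 2026 the pub-hodgecm-mathlib formalisation cell (harness21).  Prover seat hodgecm-mathlib-B-p14 (g42): the EXACT CONDUCTOR `2e + 1 − s` and INDEX TWO for a
UNIT `u = 1 + w` of odd quadratic defect — by SYMMETRY from the four ★ wild-quadratic files (LH4-plan (g3) WORDs #25∕#30∕#35; census F0P3a-p06 (g17) §3); 2026-09-02.
-/
import Literature.NumberTheory.LocalFields.WildQuadraticNormIndexTwo   -- ★ 63:11 dichotomy; brings ★ Descent, ★ Exactness (X1)–(X6), ★ NearOne (W1)–(W4)
import HarnessLib

/-!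
# Wild quadratic norms — the UNIT CASE: `a(K(√(1+w))∕K) = 2·ord 2 + 1 − s` exactly for `ord w = s` odd `< 2·ord 2`, the dyadic symbol
# `(1 + w, 1 + 4η∕w) = −1 ⟺ η̄ ∉ ℘(𝓀)`, and `[K^× : N(K(√(1+w))^×)] = 2` — all by the symmetry `x ∈ N_u ⟺ u ∈ N_{−wx}` from ★ O'Meara 63:11

Topic `NumberTheory/LocalFields`; namespace `Literature.NumberTheory.LocalFields`.  THEOREMS ONLY (no definition, no instance, no notation, no named fact, no `sorry`);
CM-free; kernel lane `--supports stmt-HodgeConjecture-24833`.  Cell `pub/hodgecm-mathlib` (D-0151), crux H413 = `stmt-HodgeConjecture-24833`; half A line LH4, DYADIC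
pay-down leaf `Cruxes/H413/Lines/F0_P3c_DyadicPaydown.lean`, organs (D-UNR)∕(D-RAM) (PRINT this week; census F0P3a-p06 (g17) OUTCOME B: mechanisms M3∕M4∕M6 key on the
WILD CONDUCTOR `a(K₂∕L_w)` — THIS file computes it for every unit of odd defect).  Fifth file of the wild quadratic entry layer: ★ `WildQuadraticNormsNearOne` ((W1)–(W4)),
★ `WildQuadraticNormsExactness` ((X1)–(X6)), ★ `WildQuadraticNormDescent`, ★ `WildQuadraticNormIndexTwo` (63:11 for `u` of ODD ORDER: `K^× = N ⊔ ΔN`).  Same define-free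
currency (`Valued.v : K → ℤᵐ⁰`; «`x ∈ N_u = N(K(√u)^×)`» := `∃ a b, a·a − u·(b·b) = x`; «`η̄ ∉ ℘(𝓀)`» := `∀ ρ, v ρ ≤ 1 → 1 ≤ v(ρ·ρ + ρ − η)`; «odd order» :=
`∀ y, v w ≠ v y·v y`).  HONEST LABEL: HC_CM is proved only modulo the 7 printed citations (2 remaining named inputs: hLiu418 = stmt-HodgeConjecture-24832, h413 =
stmt-HodgeConjecture-24833) until rung 0 closes; count-neutral, Mathlib-footed, bankable.

THE MATHEMATICS.  For `u = 1 + w` (`v w < 1`) the norm group `N_u` is a GROUP (★ Brahmagupta, ★ `…_eq_inv`) containing `−w = 1² − u·1²`; hence for `x ≠ 0`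
**`x ∈ N_u ⟺ −wx ∈ N_u ⟺ u ∈ N_{−wx}`** (★ symmetry (X1)).  When `ord w = s` is ODD and `x` is a unit, `−wx` has ODD ORDER — where ★ `WildQuadraticNormIndexTwo` knows
everything.  Consequences, with no new case analysis:
* §1 (C1) «COMPLEMENTARY DEPTHS» `exists_sq_sub_one_add_mul_sq_eq_of_valued_mul_lt_four` — **`v(w·(x − 1)) < v 4 ⇒ x ∈ N(K(√(1+w)))`** for ANY `w` with `v w < 1`
  (`1 + wx = 1 − (−wx) ∈ N_{−wx}`, and `(1 + wx)∕(1 + w) = 1 + w(x−1)∕(1+w)` is `4𝓂`-close to `1`, hence a square by ★ (W-a); so `u ∈ N_{−wx}`, symmetry, divide by `−w`).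
  Classically `(1 + α, 1 + β) = 1` whenever `αβ ∈ 4𝓂` [Serre XIV §4 ex.]; in conductor terms **`U^{(2e+1−s)} ⊆ N(K(√(1+w)))`** for `ord w = s` (any parity).
* §2 (C2) «THE DYADIC SYMBOL» `not_exists_sq_sub_one_add_mul_sq_eq_one_add_four_mul_mul_inv` — **`v 4 < v w < 1`, `v w` odd, `η̄ ∉ ℘(𝓀) ⇒ 1 + 4η∕w ∉ N(K(√(1+w)))`**:
  else `u ∈ N_{v′}`, `v′ = −w − 4η` of odd order `s`; but `1 + w + 4η = 1 − v′ ∈ N_{v′}` and `(1 + w + 4η)∕(1 + w) = 1 + 4η″` with `η̄″ = η̄`, so `(1 + 4η″)(1 + 4η) ∈ 1 + 4𝓂`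
  is a square and `u(1 + 4η) ∈ N_{v′}` as well — `1 + 4η ∈ N_{v′}`, against ★ (X4) for the odd-order `v′` (with `Δ := 1 + 4η` itself: no residue-index input, no
  uniformiser).  With §1: **`a(K(√(1+w))∕K) = 2e + 1 − s` EXACTLY** for every unit of odd defect `s < 2e` [O'Meara 63:11a∕§63B; Serre XV §2], i.e. the classical
  `(1 + w, 1 + 4η∕w)_𝔭 = (−1)^{Tr η̄}`.
* §3 `conductor_one_add_adicCompletion` — (C1) + (C2) in `F_v` at a dyadic place of a number field, `η` supplied by ★ (X6).
The INDEX-TWO statement for a unit of odd defect (`∀ y ≠ 0, y ∈ N_u ∨ y·(1 + 4η∕w) ∈ N_u`, not both) is the sequel file `WildQuadraticNormsUnitIndexTwo`.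

## References
* [Omeara1963] O. T. O'Meara, *Introduction to Quadratic Forms*, Grundlehren 117 (1963), §63B 63:10–63:11a (held copy p. 168–170), §63A 63:2–63:5 (quadratic defect).
* [Serre1979] J.-P. Serre, *Local Fields*, GTM 67 (1979), Ch. XIV §§3–4 (local symbols, the dyadic computation); Ch. XV §2 (norm groups and conductors).
* [NeukirchANT1999] J. Neukirch, *Algebraic Number Theory* (1999), Ch. V (1.3) (local norm index), Ch. V §3 (Hilbert symbol at dyadic places).
-/

set_option autoImplicit false

noncomputable section

open scoped Valued WithZero
open WithZero NumberField IsDedekindDomain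

namespace Literature.NumberTheory.LocalFields

/-! ## §0 `−w ∈ N(K(√(1+w)))`, `1 − v ∈ N(K(√v))`, and the `−w`-transport -/
section Transport
variable {K : Type*} [Field K]

/-- `−w = 1·1 − (1 + w)·(1·1)` is a norm from `K(√(1+w))`. [cite: Omeara1963, §63B 63:10] -/
theorem exists_sq_sub_one_add_mul_sq_eq_neg (w : K) : ∃ a b : K, a * a - (1 + w) * (b * b) = -w := ⟨1, 1, by ring⟩

/-- `1 − v = 1·1 − v·(1·1)` is a norm from `K(√v)`. [cite: Omeara1963, §63B 63:10] -/
theorem exists_sq_sub_mul_sq_eq_one_sub (v : K) : ∃ a b : K, a * a - v * (b * b) = 1 - v := ⟨1, 1, by ring⟩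

/-- **`−w`-TRANSPORT**: for `w ≠ 0`, `x ∈ N(K(√(1+w))) ⟺ −(w·x) ∈ N(K(√(1+w)))` (multiply by the norm `−w`, resp. its inverse; ★ Brahmagupta, ★ `…_eq_inv`).
[cite: Omeara1963, §63B 63:10] -/
theorem exists_sq_sub_one_add_mul_sq_iff_neg_mul {w : K} (hw0 : w ≠ 0) (x : K) :
    (∃ a b : K, a * a - (1 + w) * (b * b) = x) ↔ ∃ a b : K, a * a - (1 + w) * (b * b) = -(w * x) := by
  constructor
  · intro h
    have h' := exists_sq_sub_mul_sq_eq_mul (1 + w) h (exists_sq_sub_one_add_mul_sq_eq_neg w)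
    rwa [show x * -w = -(w * x) by ring] at h'
  · intro h
    have h' := exists_sq_sub_mul_sq_eq_mul (1 + w) h (exists_sq_sub_mul_sq_eq_inv (1 + w) (exists_sq_sub_one_add_mul_sq_eq_neg w))
    rwa [show -(w * x) * (-w)⁻¹ = x by field_simp] at h'

end Transport

/-! ## §1 (C1) Complementary depths: `v(w·(x − 1)) < v 4 ⇒ x ∈ N(K(√(1+w)))` -/
section Complementary
variable {K : Type*} [Field K] [Valued K ℤᵐ⁰]

/-- **(C1) COMPLEMENTARY DEPTHS GIVE NORMS** (`(1 + α, 1 + β) = 1` for `αβ ∈ 4𝓂`; in conductor terms `U^{(2e+1−s)} ⊆ N(K(√(1+w)))` for `ord w = s`): in a complete `K` with `2 ≠ 0`,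
if `v w < 1` and `v(w·(x − 1)) < v 4` then `x = a·a − (1 + w)·(b·b)`.  Proof: `1 + wx = 1 − (−wx) ∈ N_{−wx}`; `1 + wx = (1 + w)(1 + μ)`, `μ = w(x−1)∕(1+w)`, `v μ < v 4`, so
`1 + μ = r²` (★ (W-a)) and `1 + w ∈ N_{−wx}`; by ★ symmetry (X1) `−wx ∈ N_{1+w}`, and `x = (−wx)·(−w)⁻¹`.  (`w = 0`: the hyperbolic form; `x = 0`: then `1 + w` is a square.)
[cite: Serre1979, Ch. XIV §4; Ch. XV §2] [cite: Omeara1963, §63B 63:11a] -/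
theorem exists_sq_sub_one_add_mul_sq_eq_of_valued_mul_lt_four [IsAdicComplete 𝓂[K] 𝒪[K]] (h2 : (2 : K) ≠ 0) {w x : K} (hw : Valued.v w < 1)
    (hwx : Valued.v (w * (x - 1)) < Valued.v (4 : K)) : ∃ a b : K, a * a - (1 + w) * (b * b) = x := by
  by_cases hw0 : w = 0
  · refine ⟨(x + 1) * (2 : K)⁻¹, (x - 1) * (2 : K)⁻¹, ?_⟩
    rw [hw0]
    field_simp
    ring
  have hu1 : Valued.v (1 + w) = 1 := Valuation.map_one_add_of_lt _ hw
  have hu0 : 1 + w ≠ 0 := (Valuation.ne_zero_iff _).1 (by rw [hu1]; exact one_ne_zero)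
  by_cases hx0 : x = 0
  · -- `v w < v 4`: `1 + w = r²`, and `r·r − (1 + w)·1 = 0`
    rw [hx0, zero_sub, mul_neg_one, Valuation.map_neg] at hwx
    obtain ⟨r, hr, -⟩ := exists_mul_self_eq_of_valued_sub_one_lt_four (1 + w) (by rwa [add_sub_cancel_left])
    exact ⟨r, 1, by rw [hx0, hr]; ring⟩
  -- `μ := w(x − 1)∕(1 + w)`, `1 + μ = r²`
  have hv4le : Valued.v (4 : K) ≤ 1 := by
    have h := (4 : 𝒪[K]).2
    rw [Valuation.mem_integer_iff] at h
    exact_mod_cast h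
  set μ : K := w * (x - 1) * (1 + w)⁻¹ with hμ
  clear_value μ
  have hvμ4 : Valued.v μ < Valued.v (4 : K) := by
    rw [hμ, map_mul, map_inv₀, hu1, inv_one, mul_one]
    exact hwx
  obtain ⟨r, hr, -⟩ := exists_mul_self_eq_of_valued_sub_one_lt_four (1 + μ) (by rwa [add_sub_cancel_left])
  have hr0 : r ≠ 0 := by
    rintro rfl
    have h1 : Valued.v (1 + μ) = 1 := Valuation.map_one_add_of_lt _ (hvμ4.trans_le hv4le)
    rw [← hr, zero_mul, map_zero] at h1
    exact zero_ne_one h1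
  have hμid : 1 + w * x = (1 + w) * (1 + μ) := by
    rw [hμ]
    field_simp
    ring
  -- `1 + wx ∈ N_{−wx}`, hence `1 + w = (1 + wx)·r⁻² ∈ N_{−wx}`
  have h1 : ∃ a b : K, a * a - -(w * x) * (b * b) = 1 + w * x := ⟨1, 1, by ring⟩
  have h2' : ∃ a b : K, a * a - -(w * x) * (b * b) = 1 + w := by
    have h := exists_sq_sub_mul_sq_eq_mul (-(w * x)) h1 (exists_sq_sub_mul_sq_eq_mul_self _ r⁻¹)
    rwa [show (1 + w * x) * (r⁻¹ * r⁻¹) = 1 + w by rw [hμid, ← hr]; field_simp] at h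
  -- symmetry: `−wx ∈ N_{1+w}`, then divide by `−w`
  exact (exists_sq_sub_one_add_mul_sq_iff_neg_mul hw0 x).2 (exists_sq_sub_mul_sq_symm h2 hu0 h2')

/-- (C1) in the symmetric «two one-units» form: `v((u − 1)·(x − 1)) < v 4 ⇒ x ∈ N(K(√u))` for a one-unit `u` (`v(u − 1) < 1`). [cite: Serre1979, Ch. XIV §4] -/
theorem exists_sq_sub_mul_sq_eq_of_valued_sub_one_mul_sub_one_lt_four [IsAdicComplete 𝓂[K] 𝒪[K]] (h2 : (2 : K) ≠ 0) {u x : K}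
    (hu : Valued.v (u - 1) < 1) (hux : Valued.v ((u - 1) * (x - 1)) < Valued.v (4 : K)) : ∃ a b : K, a * a - u * (b * b) = x := by
  have h := exists_sq_sub_one_add_mul_sq_eq_of_valued_mul_lt_four h2 hu hux
  rwa [add_sub_cancel] at h

end Complementary

/-! ## §2 (C2) The dyadic symbol `(1 + w, 1 + 4η∕w) = −1` -/
section Symbol
variable {K : Type*} [Field K] [Valued K ℤᵐ⁰]

/-- Transfer of «`η̄ ∉ ℘(𝓀)`» along a congruence: if `v(η′ − η) < 1` then `η̄′ ∉ ℘(𝓀)` as well (define-free). [cite: Omeara1963, §63A 63:3] -/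
theorem forall_one_le_valued_artinSchreier_sub_of_valued_sub_lt_one {η η' : K} (hη : ∀ ρ : K, Valued.v ρ ≤ 1 → 1 ≤ Valued.v (ρ * ρ + ρ - η))
    (hηη' : Valued.v (η' - η) < 1) : ∀ ρ : K, Valued.v ρ ≤ 1 → 1 ≤ Valued.v (ρ * ρ + ρ - η') := by
  intro ρ hρ
  have h := hη ρ hρ
  rw [show ρ * ρ + ρ - η' = ρ * ρ + ρ - η - (η' - η) by ring, Valuation.map_sub_eq_of_lt_left _ (hηη'.trans_le h)]
  exact h

/-- **(C2) THE DYADIC SYMBOL `(1 + w, 1 + 4η∕w) = −1`** — the EXACT CONDUCTOR `2·ord 2 + 1 − s` of `K(√(1+w))∕K` for a unit of ODD quadratic defect `s`: in a complete `K` with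
`2 ≠ 0`, `v 2 < 1`, if `v 4 < v w < 1` with `v w` not a square value (odd `s < 2e`) and `η̄ ∉ ℘(𝓀)`, then `1 + 4η·w⁻¹` (depth exactly `2e − s`) is NOT a norm from `K(√(1+w))`.
Proof by symmetry: otherwise `u = 1 + w ∈ N_{v′}` for `v′ = −w − 4η` (★ (X1); `v′` has the odd order of `w`); but `1 + w + 4η = 1 − v′ ∈ N_{v′}`, and
`(1 + w + 4η)(1 + 4η) = (1 + w)·(1 + 4η″)(1 + 4η)` with `η″ = η∕(1+w) ≡ η`, where `(1 + 4η″)(1 + 4η) ∈ 1 + 4𝓂` is a square (★ (W-a)) — so `u(1 + 4η) ∈ N_{v′}` too and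
`1 + 4η ∈ N_{v′}`, contradicting ★ (X4) `not_exists_sq_sub_mul_sq_eq_one_add_four_mul` for the odd-order `v′`.  With §1, `U^{(2e+1−s)} ⊆ N ⊅ U^{(2e−s)}`.
[cite: Omeara1963, §63B 63:11a] [cite: Serre1979, Ch. XIV §4; Ch. XV §2] [cite: NeukirchANT1999, Ch. V §3] -/
theorem not_exists_sq_sub_one_add_mul_sq_eq_one_add_four_mul_mul_inv [IsAdicComplete 𝓂[K] 𝒪[K]] (h2 : (2 : K) ≠ 0) (h2v : Valued.v (2 : K) < 1)
    {w : K} (hw1 : Valued.v w < 1) (h4w : Valued.v (4 : K) < Valued.v w) (hwodd : ∀ y : K, Valued.v w ≠ Valued.v y * Valued.v y)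
    {η : K} (hη1 : Valued.v η ≤ 1) (hη : ∀ ρ : K, Valued.v ρ ≤ 1 → 1 ≤ Valued.v (ρ * ρ + ρ - η)) :
    ¬ ∃ a b : K, a * a - (1 + w) * (b * b) = 1 + 4 * η * w⁻¹ := by
  intro hx
  have hw0 : w ≠ 0 := fun h => hwodd 0 (by rw [h, map_zero, mul_zero])
  have hu1 : Valued.v (1 + w) = 1 := Valuation.map_one_add_of_lt _ hw1
  have hu0 : 1 + w ≠ 0 := (Valuation.ne_zero_iff _).1 (by rw [hu1]; exact one_ne_zero)
  have hv4 : Valued.v (4 * η) < Valued.v w := by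
    rw [map_mul]
    exact (mul_le_of_le_one_right' hη1).trans_lt h4w
  -- `v′ := −w − 4η = −(w·x₀)` has the odd order of `w`
  have hv'eq : -(w * (1 + 4 * η * w⁻¹)) = -w - 4 * η := by
    field_simp
    ring
  have hv'val : Valued.v (-w - 4 * η) = Valued.v w := by
    rw [show -w - 4 * η = -(w + 4 * η) by ring, Valuation.map_neg, Valuation.map_add_eq_of_lt_left _ hv4]
  have hv'odd : ∀ y : K, Valued.v (-w - 4 * η) ≠ Valued.v y * Valued.v y := by
    rw [hv'val]
    exact hwodd
  have hv'0 : -w - 4 * η ≠ 0 := (Valuation.ne_zero_iff _).1 (by rw [hv'val]; exact (Valuation.ne_zero_iff _).2 hw0)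
  -- symmetry: `u ∈ N_{v′}`
  have hv' : ∃ a b : K, a * a - (1 + w) * (b * b) = -w - 4 * η := by
    rw [← hv'eq]
    exact (exists_sq_sub_one_add_mul_sq_iff_neg_mul hw0 _).1 hx
  have hu_in : ∃ c d : K, c * c - (-w - 4 * η) * (d * d) = 1 + w := exists_sq_sub_mul_sq_symm h2 hv'0 hv'
  -- `1 + w + 4η ∈ N_{v′}`; `(1 + 4η″)(1 + 4η)` is a square, `η″ = η∕(1+w)`
  have h145 : ∃ c d : K, c * c - (-w - 4 * η) * (d * d) = 1 + w + 4 * η := ⟨1, 1, by ring⟩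
  have hv4le : Valued.v (4 : K) ≤ 1 := by
    have h := (4 : 𝒪[K]).2
    rw [Valuation.mem_integer_iff] at h
    exact_mod_cast h
  have hsq : Valued.v ((1 + 4 * (η * (1 + w)⁻¹)) * (1 + 4 * η) - 1) < Valued.v (4 : K) := by
    have hid : (1 + 4 * (η * (1 + w)⁻¹)) * (1 + 4 * η) - 1 = 4 * (η * ((2 + w) * (1 + w)⁻¹) + 4 * (η * (1 + w)⁻¹ * η)) := by
      field_simp
      ring
    rw [hid, map_mul]
    have hv40 : Valued.v (4 : K) ≠ 0 := by
      rw [show (4 : K) = 2 * 2 by norm_num]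
      exact (Valuation.ne_zero_iff _).2 (mul_ne_zero h2 h2)
    have hv4lt : Valued.v (4 : K) < 1 := by
      rw [show (4 : K) = 2 * 2 by norm_num, map_mul]
      exact mul_lt_one' h2v h2v
    refine lt_of_lt_of_eq (mul_lt_mul_of_pos_left ?_ (zero_lt_iff.2 hv40)) (mul_one _)
    refine Valuation.map_add_lt _ ?_ ?_
    · rw [map_mul, map_mul, map_inv₀, hu1, inv_one, mul_one]
      exact (mul_le_of_le_one_left' hη1).trans_lt (Valuation.map_add_lt _ h2v hw1)
    · rw [map_mul, map_mul, map_mul, map_inv₀, hu1, inv_one, mul_one]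
      exact mul_lt_one_of_lt_of_le hv4lt (mul_le_one' hη1 hη1)
  obtain ⟨r, hr, -⟩ := exists_mul_self_eq_of_valued_sub_one_lt_four _ hsq
  have hv4lt : Valued.v (4 : K) < 1 := by
    rw [show (4 : K) = 2 * 2 by norm_num, map_mul]
    exact mul_lt_one' h2v h2v
  set t : K := 1 + 4 * (η * (1 + w)⁻¹) with ht
  clear_value t
  have ht1 : Valued.v t = 1 := by
    rw [ht]
    refine Valuation.map_one_add_of_lt _ ?_
    rw [map_mul, map_mul, map_inv₀, hu1, inv_one, mul_one]
    exact mul_lt_one_of_lt_of_le hv4lt hη1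
  have ht0 : t ≠ 0 := (Valuation.ne_zero_iff _).1 (by rw [ht1]; exact one_ne_zero)
  have hΔ1 : Valued.v (1 + 4 * η) = 1 := by
    refine Valuation.map_one_add_of_lt _ ?_
    rw [map_mul]
    exact mul_lt_one_of_lt_of_le hv4lt hη1
  have hr0 : r ≠ 0 := by
    rintro rfl
    rw [zero_mul] at hr
    have h := congrArg Valued.v hr
    rw [map_zero, map_mul, ht1, hΔ1, mul_one] at h
    exact zero_ne_one h
  have hut : (1 + w) * t = 1 + w + 4 * η := by
    rw [ht]
    field_simp
  -- `u(1 + 4η) = (1 + w + 4η)·(r t⁻¹)² ∈ N_{v′}`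
  have huΔ : ∃ c d : K, c * c - (-w - 4 * η) * (d * d) = (1 + w) * (1 + 4 * η) := by
    have h := exists_sq_sub_mul_sq_eq_mul _ h145 (exists_sq_sub_mul_sq_eq_mul_self _ (r * t⁻¹))
    have key : (1 + w + 4 * η) * (r * t⁻¹ * (r * t⁻¹)) = (1 + w) * (1 + 4 * η) := by
      rw [← hut, show r * t⁻¹ * (r * t⁻¹) = (r * r) * (t⁻¹ * t⁻¹) by ring, hr]
      field_simp
    rwa [key] at h
  -- so `1 + 4η = u(1 + 4η)·u⁻¹ ∈ N_{v′}`: contradiction with (X4)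
  have hΔ : ∃ c d : K, c * c - (-w - 4 * η) * (d * d) = 1 + 4 * η := by
    have h := exists_sq_sub_mul_sq_eq_mul _ huΔ (exists_sq_sub_mul_sq_eq_inv _ hu_in)
    rwa [show (1 + w) * (1 + 4 * η) * (1 + w)⁻¹ = 1 + 4 * η by field_simp] at h
  exact not_exists_sq_sub_mul_sq_eq_one_add_four_mul h2 hv'odd hη1 hη hΔ

end Symbol

/-! ## §3 The exact conductor at a dyadic place of a number field -/
section AdicCompletion
variable (F : Type*) [Field F] [NumberField F] (v : HeightOneSpectrum (𝓞 F))

/-- **THE EXACT CONDUCTOR `2·ord_v 2 + 1 − s` IN `F_v`** (a number field `F`, a DYADIC place `v`: `v(2) < 1`), for a unit `u = 1 + w ∈ F_v` of ODD quadratic defect `s < 2·ord_v 2`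
(`v 4 < v w < 1`, `v w` not a square value): (i) every `x` with `v(w·(x − 1)) < v 4` — i.e. `x ∈ U^{(2e+1−s)}` — is a norm from `F_v(√u)` ((C1), for every `w` with `v w < 1`);
(ii) there is `η ∈ 𝒪_v` (indeed any `η̄ ∉ ℘(𝓀_v)`, ★ (X6)) with `1 + 4η∕w ∈ U^{(2e−s)}` NOT a norm ((C2)).  Hypothesis-free but for the shape of `w`.
[cite: Omeara1963, §63B 63:11a] [cite: Serre1979, Ch. XIV §4; Ch. XV §2] [cite: NeukirchANT1999, Ch. V §3] -/
theorem conductor_one_add_adicCompletion (h2v : Valued.v (2 : v.adicCompletion F) < 1) {w : v.adicCompletion F} (hw1 : Valued.v w < 1)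
    (h4w : Valued.v (4 : v.adicCompletion F) < Valued.v w) (hwodd : ∀ y : v.adicCompletion F, Valued.v w ≠ Valued.v y * Valued.v y) :
    (∀ x : v.adicCompletion F, Valued.v (w * (x - 1)) < Valued.v (4 : v.adicCompletion F) → ∃ a b : v.adicCompletion F, a * a - (1 + w) * (b * b) = x) ∧
      ∃ η : v.adicCompletion F, Valued.v η ≤ 1 ∧ ¬ ∃ a b : v.adicCompletion F, a * a - (1 + w) * (b * b) = 1 + 4 * η * w⁻¹ := by
  haveI := Literature.NumberTheory.Automorphic.isAdicComplete_valuedMaximalIdeal_valuedInteger_adicCompletion F v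
  haveI : Finite 𝓀[v.adicCompletion F] := Literature.NumberTheory.Automorphic.finite_residueField_adicCompletion F v
  have h2 : (2 : v.adicCompletion F) ≠ 0 := by
    rw [show (2 : v.adicCompletion F) = algebraMap F (v.adicCompletion F) 2 by rw [map_ofNat]]
    exact (_root_.map_ne_zero (algebraMap F (v.adicCompletion F))).2 two_ne_zero
  obtain ⟨η, hη1, hη⟩ := exists_forall_one_le_valued_artinSchreier_sub (K := v.adicCompletion F) h2v
  exact ⟨fun x hx => exists_sq_sub_one_add_mul_sq_eq_of_valued_mul_lt_four h2 hw1 hx,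
    η, hη1, not_exists_sq_sub_one_add_mul_sq_eq_one_add_four_mul_mul_inv h2 h2v hw1 h4w hwodd hη1 hη⟩

end AdicCompletion



end Literature.NumberTheory.LocalFields

end
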